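import Summits.CriticalPhenomena.SAWScalingLimit.Theses.SAWCutPointCondensation
import Literature.Probability.RandomPlanarGeometry.BlobTimeDomainLaw
import Literature.Probability.RandomPlanarGeometry.SAWScalingLimitFamily
import HarnessLib.Audit

/-!
# Birth skeleton (BC3) for the crux `CondensationLimit` (stmt-CriticalPhenomena-7346)

Route `SAWCutPointCondensation` of `CriticalPhenomena/SAWScalingLimit`, crux r2 = step (S)
"Q_g → P as g → ∞, P chordal with the two-sided restriction property, carried by simple curves
meeting ∂D only at a, b" ('reward the cut points until they condense: the blobs between
consecutive cut points die in the infrared').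

The crux is a `∀ Q, (window hypothesis) → ∃ P, chordal ∧ restriction ∧ simple/boundary-avoiding
∧ (Q g D ⇒ P D as g → ∞ on approximable domains)` statement.  The window hypothesis is the
lattice characterisation of the near-Brownian window family of `CutPointWindowLimit`; we name it
`IsWindowFamily Q` (stated with the tree's notion `BlobTime.domainLaw`, whose `domainLaw_eq` is
`rfl` to the term inlined in the route items, so `isWindowFamily_iff` below is `Iff.rfl`).

## The line (the route header's foreseen glued split "TiltedExcursionTight → LimitRestrictionSimple
→ CondensationLimit", cut along its four distinct mechanisms; 4 registered stubs)

* `stub_windowTight` (TiltedExcursionTight) — the window laws `{Q g D : g ≥ 1}` are tight on the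
  Polish curve space, UNIFORMLY IN THE COUPLING `g` (Aizenman–Burchard / Kemppainen–Smirnov-type
  annulus-crossing bounds for the cut-point-tilted excursion, uniform in `g`; exact restriction at
  every `g` localises).  Why it might fail: KS-type crossing bounds are unproved even for the SAW.
* `stub_infraredLimit` (CONDENSATION proper = existence of the strong-coupling limit) — given the
  uniform tightness, the full limit `g → ∞` exists on every approximable Dobrushin domain and is
  chordal: all subsequential infrared limits coincide (zoom = flow: `Q_g(R·D) = R_* Q_{R^{3/4} g}(D)`
  turns `g → ∞` at fixed `D` into the large-domain limit at fixed `g`; chordality passes to the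
  limit by portmanteau, the endpoint/closure conditions being closed).  Why it might fail: an
  intermediate 'beaded' fixed point with several accumulation points of `Q_g` (no monotone
  coupling in `g` is known).
* `stub_restrictionInherited` (first half of LimitRestrictionSimple) — the EXACT lattice
  restriction identity of `BL_t` in nested discrete domains (the weight is a function of the path)
  passes through the two weak limits `δ → 0⁺`, `g → ∞`: every chordal infrared limit has the
  two-sided restriction property `ChordalFamily.IsRestriction`.  Why it might fail:
  `∂{γ ⊆ closure D'}` may carry mass for the limit (continuity-set issue at rough `∂D'`), and the
  largest-component convention of `discreteDomainGraph` makes lattice restriction exact only up to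
  boundary effects.
* `stub_blobsDie` (second half: 'the blobs die in the infrared') — every chordal infrared limit is
  carried by SIMPLE curves meeting `∂D` only at the marked points.  Why it might fail: macroscopic
  blobs could survive `g → ∞` in the continuum (nothing prices a blob at a definite amount after
  `δ → 0`), or the condensate could creep along `∂D`.

`CondensationLimit_of` is the kernel-checked composition (sorry-free; sorries live only in the
four `stub_*`): tightness feeds the existence stub, whose limit `P` inherits restriction and
simplicity from the last two stubs; every Dobrushin domain is approximable
(`SAW.exists_isEndpointApprox`, tree theorem), so `IsInfraredLimit Q P` pins `P` everywhere and
the universally-quantified `P` of stubs 3–4 is the canonical one.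

Disproof / negatives used: no `Disproof.lean` exists for this crux yet (no workfiles at
registration); `ledger negatives --problem CriticalPhenomena` (11 entries) — the only nearby one is
stmt-0772 (tightness of LATTICE laws over ALL meshes `δ ∈ (0,1]`, refuted by far-away junk
endpoints at `δ > 1/2`); `stub_windowTight` concerns the CONTINUUM window laws `Q g D`, `g ≥ 1`,
each pinned (for `g > 0`) as a weak limit along `𝓝[>] 0`, so the witness does not apply; every
`δ`-quantifier here is along `𝓝[>] 0` (inside `TendstoLaw`).
-/

noncomputable section

open MeasureTheory Filter Topology Set
open Literature.Probability.LatticeModels Literature.Probability.RandomPlanarGeometry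
open Literature.Probability.RandomPlanarGeometry.SAW (IsEndpointApprox exists_isEndpointApprox)
open scoped ENNReal NNReal BoundedContinuousFunction

namespace Summit.CriticalPhenomena.SAWScalingLimit.Cruxes.CondensationLimit.Birth

open Summit.CriticalPhenomena.SAWScalingLimit.Theses.SAWCutPointCondensation (CondensationLimit)

/-! ### 1. Vocabulary shared by the stubs -/

/-- The critical blob-time law in the near-Brownian window, `BL_{exp(-g δ^{3/4})}(Ω_δ; a_δ, b_δ)`,
pushed to curves (tree notion `BlobTime.domainLaw`). -/
def windowLaw (g : ℝ) (D : DobrushinDomain) (a b : ℝ → Site 2) (δ : ℝ) : Measure (CurveClass ℂ) :=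
  BlobTime.domainLaw (Real.exp (-(g * δ ^ (3 / 4 : ℝ)))) D.carrier δ (a δ) (b δ)

/-- `Q` is a **window family** (the hypothesis of the crux; the conclusion of
`CutPointWindowLimit` made a property of `Q`): for every `g > 0`, `Q g` is chordal and is the
`δ → 0⁺` weak limit of the window laws in every approximable Dobrushin domain. -/
def IsWindowFamily (Q : ℝ → ChordalFamily) : Prop :=
  ∀ g : ℝ, 0 < g → (Q g).IsChordal ∧
    ∀ (D : DobrushinDomain) (a b : ℝ → Site 2), IsEndpointApprox D a b →
      TendstoLaw (fun (_ : ℝ) (x : CurveClass ℂ) => x) (fun δ => windowLaw g D a b δ) id ((Q g) D)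

/-- `P` is an **infrared (strong-coupling) limit** of `Q`: `Q g D ⇒ P D` weakly as `g → ∞`
(bounded continuous test functions) on every approximable Dobrushin domain — the convergence
clause of the crux. -/
def IsInfraredLimit (Q : ℝ → ChordalFamily) (P : ChordalFamily) : Prop :=
  ∀ (D : DobrushinDomain) (a b : ℝ → Site 2), IsEndpointApprox D a b →
    ∀ f : CurveClass ℂ →ᵇ ℝ,
      Tendsto (fun g : ℝ => ∫ x, f x ∂(Q g D)) atTop (𝓝 (∫ x, f x ∂(P D)))

open scoped Classical in
/-- `IsWindowFamily Q` IS the hypothesis of `CondensationLimit`, verbatim (elaborated, as in the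
route file, under `open scoped Classical`; `BlobTime.domainLaw_eq` is `rfl`). -/
theorem isWindowFamily_iff (Q : ℝ → ChordalFamily) :
    IsWindowFamily Q ↔
      (∀ g : ℝ, 0 < g → (Q g).IsChordal ∧ ∀ (D : Literature.Probability.RandomPlanarGeometry.DobrushinDomain) (a b : ℝ → Literature.Probability.LatticeModels.Site 2), Literature.Probability.RandomPlanarGeometry.SAW.IsEndpointApprox D a b → Literature.Probability.RandomPlanarGeometry.TendstoLaw (fun (_ : ℝ) (x : Literature.Probability.RandomPlanarGeometry.CurveClass ℂ) => x) (fun δ => ((fun S : MeasureTheory.Measure (Literature.Probability.RandomPlanarGeometry.CurveClass ℂ) => (S Set.univ)⁻¹ • S) (MeasureTheory.Measure.sum fun p : (Literature.Probability.LatticeModels.discreteDomainGraph D.carrier δ).Walk (a δ) (b δ) => ENNReal.ofReal ((⨅ n : ℕ, (∑ v ∈ Literature.Probability.LatticeModels.box 2 (n + 1), ∑ q ∈ (Literature.Probability.LatticeModels.zdGraph 2).finsetWalkLength (n + 1) (0 : Literature.Probability.LatticeModels.Site 2) v, (Real.exp (-(g * δ ^ (3 / 4 : ℝ)))) ^ (q.length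 - ((Finset.range q.length).filter fun j => ∀ i ∈ Finset.range (j + 1), ∀ k ∈ Finset.Ioc j q.length, q.getVert i ≠ q.getVert k).card)) ^ (1 / ((n : ℝ) + 1)))⁻¹ ^ p.length * (Real.exp (-(g * δ ^ (3 / 4 : ℝ)))) ^ (p.length - ((Finset.range p.length).filter fun j => ∀ i ∈ Finset.range (j + 1), ∀ k ∈ Finset.Ioc j p.length, p.getVert i ≠ p.getVert k).card)) • MeasureTheory.Measure.dirac (Literature.Probability.RandomPlanarGeometry.CurveClass.mk ⟨p.toCurve (Literature.Probability.LatticeModels.meshPoint δ)⟩)))) id ((Q g) D)) :=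
  Iff.rfl

/-! ### 2. Registered stubs (the ONLY sorries of this file) -/

/-- **stub 1 — TiltedExcursionTight.** For a window family `Q`, on every approximable Dobrushin
domain the window laws `{Q g D : g ≥ 1}` form a tight set of measures on `CurveClass ℂ`,
uniformly in the coupling `g` (annulus-crossing bounds for the cut-point-tilted excursion uniform
in `g`; Aizenman–Burchard 1999 Thm 1.1, Kemppainen–Smirnov 2017). -/
theorem stub_windowTight : ∀ Q : ℝ → ChordalFamily, IsWindowFamily Q →
    ∀ (D : DobrushinDomain) (a b : ℝ → Site 2), IsEndpointApprox D a b →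
      IsTightMeasureSet ((fun g : ℝ => Q g D) '' Set.Ici (1 : ℝ)) := by
  sorry

/-- **stub 2 — existence of the strong-coupling (infrared) limit.** For a window family `Q` whose
window laws are tight uniformly in `g ≥ 1`, the full limit `g → ∞` exists and is chordal: there is
a chordal family `P` with `Q g D ⇒ P D` on every approximable Dobrushin domain (uniqueness of the
subsequential infrared limits — zoom covariance `Q_g(R·D) = R_* Q_{R^{3/4}g}(D)` makes `g → ∞` the
large-domain limit at fixed `g`; chordality by portmanteau). -/
theorem stub_infraredLimit : ∀ Q : ℝ → ChordalFamily, IsWindowFamily Q →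
    (∀ (D : DobrushinDomain) (a b : ℝ → Site 2), IsEndpointApprox D a b →
      IsTightMeasureSet ((fun g : ℝ => Q g D) '' Set.Ici (1 : ℝ))) →
    ∃ P : ChordalFamily, P.IsChordal ∧ IsInfraredLimit Q P := by
  sorry

/-- **stub 3 — restriction is inherited by the infrared limit.** The exact lattice restriction
identity of the blob-time laws in nested discrete domains (the weight `y_c(t)^{|p|} t^{B(p)}` is a
function of the path) passes through the weak limits `δ → 0⁺` and `g → ∞`: every chordal infrared
limit of a window family has the two-sided restriction property (LSW 2003 §1, §3). -/
theorem stub_restrictionInherited : ∀ (Q : ℝ → ChordalFamily) (P : ChordalFamily),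
    IsWindowFamily Q → P.IsChordal → IsInfraredLimit Q P → P.IsRestriction := by
  sorry

/-- **stub 4 — the blobs die in the infrared.** Every chordal infrared limit of a window family is
carried by simple curves meeting `∂D` only at the marked points `a = D.pt 0`, `b = D.pt 1`
(no 'beaded' intermediate fixed point; boundary touching is null). -/
theorem stub_blobsDie : ∀ (Q : ℝ → ChordalFamily) (P : ChordalFamily),
    IsWindowFamily Q → P.IsChordal → IsInfraredLimit Q P →
      ∀ D : DobrushinDomain, ∀ᵐ γ ∂(P D),
        γ ∈ CurveClass.simple ∧ γ.range ∩ frontier D.carrier ⊆ {D.pt 0, D.pt 1} := by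
  sorry

/-! ### 3. The composition (kernel-checked, no sorry of its own) -/

/-- **`CondensationLimit` from the four stubs**, concluding the route decl BY NAME: tightness
(stub 1) feeds the existence of the chordal infrared limit `P` (stub 2), which inherits the
restriction property (stub 3) and simplicity / boundary avoidance (stub 4); the convergence clause
is `IsInfraredLimit Q P` itself.  The window hypothesis of the crux is `IsWindowFamily Q` by
`isWindowFamily_iff` (`Iff.rfl`). -/
theorem CondensationLimit_of :
    (∀ Q : ℝ → ChordalFamily, IsWindowFamily Q →
      ∀ (D : DobrushinDomain) (a b : ℝ → Site 2), IsEndpointApprox D a b →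
        IsTightMeasureSet ((fun g : ℝ => Q g D) '' Set.Ici (1 : ℝ))) →
    (∀ Q : ℝ → ChordalFamily, IsWindowFamily Q →
      (∀ (D : DobrushinDomain) (a b : ℝ → Site 2), IsEndpointApprox D a b →
        IsTightMeasureSet ((fun g : ℝ => Q g D) '' Set.Ici (1 : ℝ))) →
      ∃ P : ChordalFamily, P.IsChordal ∧ IsInfraredLimit Q P) →
    (∀ (Q : ℝ → ChordalFamily) (P : ChordalFamily),
      IsWindowFamily Q → P.IsChordal → IsInfraredLimit Q P → P.IsRestriction) →
    (∀ (Q : ℝ → ChordalFamily) (P : ChordalFamily),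
      IsWindowFamily Q → P.IsChordal → IsInfraredLimit Q P →
        ∀ D : DobrushinDomain, ∀ᵐ γ ∂(P D),
          γ ∈ CurveClass.simple ∧ γ.range ∩ frontier D.carrier ⊆ {D.pt 0, D.pt 1}) →
    Summit.CriticalPhenomena.SAWScalingLimit.Theses.SAWCutPointCondensation.CondensationLimit := by
  intro hTight hLimit hRestr hSimple Q hQ
  have hQ' : IsWindowFamily Q := (isWindowFamily_iff Q).2 hQ
  obtain ⟨P, hPch, hPlim⟩ := hLimit Q hQ' (hTight Q hQ')
  exact ⟨P, hPch, hRestr Q P hQ' hPch hPlim, hSimple Q P hQ' hPch hPlim, hPlim⟩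

/-- The line applied to the registered stubs: `CondensationLimit`, sorry-free except through
`stub_windowTight`, `stub_infraredLimit`, `stub_restrictionInherited`, `stub_blobsDie`. -/
theorem CondensationLimit_proof :
    Summit.CriticalPhenomena.SAWScalingLimit.Theses.SAWCutPointCondensation.CondensationLimit :=
  CondensationLimit_of stub_windowTight stub_infraredLimit stub_restrictionInherited stub_blobsDie

end Summit.CriticalPhenomena.SAWScalingLimit.Cruxes.CondensationLimit.Birth

end
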